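import Mathlib
import HarnessLib
import Literature.Probability.LatticeModels.IsingThermodynamics
import Literature.Probability.LatticeModels.RotatedTorusDiagonalFourier
import Literature.Probability.LatticeModels.PlusFreeComparison
import Literature.Probability.LatticeModels.CriticalTwoPointBounds
import Summits.CriticalPhenomena.Ising3DConformalLimit.Theorems.PrecisionLaplacianDirectCorrelationStableTailSlabSpectralRepresentation

/-!
# Diagonal-frame slab spectral representation of the critical two-point function of the 3D Ising model

Sub-stub `stub_slabModeExpDecay_auxDiagHausdorff` (a brick of `stub_slabModeExpDecay`, the transverse
mass gap) of line `self-energy-pick-inversion`, crux `PrecisionLaplacian.DirectCorrelationStableTail`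
(stmt-CriticalPhenomena-4799): the `u = e₀ + e₁` analogue of the landed axis statement
`stub_slabSpectralRepresentation`. For every finite `s ⊂ ℤ²` (parametrising the diagonal plane
`{x₀ + x₁ = 0}` of `ℤ³` by `p = (m, z) ↦ (m, -m, z)`) and every `v : ℤ² → ℝ` there is a finite
positive measure `μ` on `[0, 1]` with, for all `n : ℕ`,
`∑_{p,q ∈ s} v p v q G((p₀ - q₀) + n, -(p₀ - q₀) + n, p₁ - q₁) = ∫ tⁿ dμ`,
`G = criticalTwoPoint 3 = ⟨σ₀σ_·⟩⁺_{β_c(3)}`: the sequence `n ↦ ∑ v_x v_y G(y - x + n(e₀ + e₁))`, `x, y`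
on the diagonal plane through `0`, is a `[0,1]`-Hausdorff moment sequence.

## Proof

Aizenman–Duminil-Copin 2021, proof of Prop. 5.4 (iii) (arXiv:1912.07973 p. 18) combined with the
proof of Prop. 8.6 (= Prop. 5.3, App. §8.3): in the diagonal direction the natural transfer matrix of
a *partially rotated* periodic box adds two layers at a time, and restricted to the even diagonal
layers it is the positive matrix `T T*`. The tree carries the finite-volume part on the rotated
torus `RotSite d'' N = ℤ/2Nℤ × (ℤ/Nℤ)^{d''+1}` (`RotatedTorus`, `RotatedTorusLayers`: even layers
`R_m(w) = σ(2m, w + m e_b)`, the positive semidefinite symmetrised two-step matrix `A = diagTransfer`,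
and `∑_σ e^{-βH} f(R₀) g(R_n) = Tr(diag f Aⁿ diag g A^{N-n})`, `sum_exp_mul_evenLayerObs_eq_trace`).
Steps, parallel to the axis file:

* rotated torus, `N ≥ 3`, coefficients `c_a` at sites `(0, w_a)` of the even layer `a = x₀ + x₁ = 0`:
  `Z · W_N(n) = Tr(diag F · Aⁿ · diag F · A^{N-n})` for `F = ∑_a c_a σ_{w_a}` and the diagonal step
  `π(n(e₀+e₁)) = (2n, n e_b)` (`Z_mul_rotDiagForm_eq_trace`), whence `W_N(n) = ∫ tⁿ dν_N` for
  `0 ≤ n < N` with a finitely supported positive measure `ν_N` on `[0, ∞)`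
  (`exists_atomicMeasure_of_spectralSum` of the axis file, `exists_rotDiagForm_moments`); its
  moments are `≤ (∑_a |c_a|)²` (`sum_mul_mul_rotTwoPoint_le`);
* `N → ∞`: the rotated-torus two-point function converges to `⟨σ₀σ_x⟩⁺_β` when `m*(β) = 0`
  (Griffiths sandwich `abs_rotTwoPoint_sub_plusCorr_le` of `RotatedTorus` with Lebowitz–Martin-Löf
  `freeCorr_eq_plusCorr_of_spontaneousMagnetization_eq_zero`; `tendsto_rotDiagForm`), and the moment
  criterion `exists_hausdorffMeasure_of_momentLimit` of the axis file gives a finite positive measure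
  on `[0, 1]` (`exists_diagForm_hausdorffMeasure`, any `d'' + 2 ≥ 2`, any `β ≥ 0` with `m*(β) = 0`);
* the stub: `d'' = 1`, `β = β_c(3) ≥ 0`, `m*(β_c(3)) = 0` (ADS 2015,
  `spontaneousMagnetization_criticalBeta_eq_zero_holds`), index type `s`, `c = v|_s`,
  `x_a = (a₀, -a₀, a₁)`, and `x_b - x_a + n(e₀+e₁) = ((b₀-a₀) + n, -(b₀-a₀) + n, b₁ - a₁)`; the order of
  summation is swapped (the parity pitfall is void: the points `(m, -m, z)` lie on the even layer
  `x₀ + x₁ = 0` and `n(e₀+e₁)` moves to the even layer `2n`).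

Sources: M. Aizenman, H. Duminil-Copin, Ann. of Math. 194 (2021), arXiv:1912.07973, proof of
Prop. 5.4 (iii) (p. 18) and App. §8.3 Prop. 8.6 (= Prop. 5.3) [AizenmanDuminilCopinAnnals2021].
Pure theorem file: no definitions.
-/

noncomputable section

namespace Summit.CriticalPhenomena.Ising3DConformalLimit.Cruxes.DirectCorrelationStableTail.SelfEnergyPickInversion

open MeasureTheory Filter Topology Set Matrix
open scoped BigOperators
open Literature.Probability.LatticeModels

/-! ### The rotated torus: diagonal forms of the periodic two-point function are truncated moment sequences -/

/-- The pair correlation of the rotated torus as a Boltzmann average (real form of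
`sum_rotWeight_mul_spin_mul_spin`): `Z ⟨σ_uσ_v⟩^{rot}_{N;β} = ∑_σ e^{-βH(σ)} σ_u σ_v`.
[cite: FriedliVelenik2017, §3.1, eq. (3.8)] -/
theorem Z_mul_rotTwoPoint_eq_sum {d'' N : ℕ} [NeZero N] (β : ℝ) (u v : RotSite d'' N) :
    isingPartitionFunction (rotGraph d'' N) Finset.univ β 0 .free * rotTwoPoint d'' N β u v =
      ∑ σ : SpinConfig (RotSite d'' N), rotWeight β 0 σ * (spinAt u σ * spinAt v σ) := by
  have h := sum_rotWeight_mul_spin_mul_spin (d'' := d'') (N := N) β 0 u v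
  rw [rotTwoPointH_zero] at h
  exact_mod_cast h.symm

/-- **Transfer-matrix representation of the diagonal form on the rotated torus** (ADC 2021, proof
of Prop. 5.4 (iii): "when restricting to even values of `x₁ + x₂` we end up with the matrix `TT*`,
which is positive"): for `N ≥ 3`, coefficients `c_a` at sites `(0, w_a)` of the even diagonal layer
`x₀ + x₁ = 0` and the layer observable `F(R) = ∑_a c_a R(w_a)`,
`Z · ∑_{a,b} c_a c_b ⟨σ_{(0,w_a)} σ_{(0,w_b) + π(n(e₀+e₁))}⟩^{rot} = Tr(diag F · Aⁿ · diag F · A^{N-n})`,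
`A` the symmetrised two-step diagonal transfer matrix, `π(n(e₀+e₁)) = (2n, n e_b)` (`evenShift`).
[cite: AizenmanDuminilCopinAnnals2021, arXiv:1912.07973 proof of Prop. 5.4 (iii) (p. 18)] -/
theorem Z_mul_rotDiagForm_eq_trace {d'' N : ℕ} [NeZero N] (hN : 3 ≤ N) (β : ℝ) {ι : Type*} [Fintype ι]
    (c : ι → ℝ) (w : ι → TorusSite (d'' + 1) N) (n : ZMod N) :
    isingPartitionFunction (rotGraph d'' N) Finset.univ β 0 .free *
        ∑ a, ∑ b, c a * c b *
          rotTwoPoint d'' N β ((0 : ZMod (2 * N)), w a) (((0 : ZMod (2 * N)), w b) + evenShift n) =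
      (diagonal (fun R : Layer (d'' + 1) N => ∑ a, c a * spinAt (w a) R) * diagTransfer β 0 ^ n.val *
        diagonal (fun R : Layer (d'' + 1) N => ∑ a, c a * spinAt (w a) R) *
          diagTransfer β 0 ^ (N - n.val)).trace := by
  classical
  set F : Layer (d'' + 1) N → ℝ := fun R => ∑ a, c a * spinAt (w a) R with hF
  rw [← sum_exp_mul_evenLayerObs_eq_trace hN β 0 F F n]
  -- the layer observable on the even layers `0` and `n`
  have hlayer : ∀ (σ : SpinConfig (RotSite d'' N)) (m : ZMod N),
      F (evenLayer σ m) = ∑ a, c a * spinAt (((0 : ZMod (2 * N)), w a) + evenShift m) σ := by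
    intro σ m
    simp only [hF]
    refine Finset.sum_congr rfl fun a _ => ?_
    rw [← spinAt_even σ m (w a), evenShift, Prod.mk_add_mk, zero_add]
  have hlayer0 : ∀ σ : SpinConfig (RotSite d'' N),
      F (evenLayer σ 0) = ∑ a, c a * spinAt ((0 : ZMod (2 * N)), w a) σ := by
    intro σ
    rw [hlayer σ 0]
    simp only [evenShift, twoMul_zero, layerShift_zero, Prod.mk_add_mk, add_zero]
  simp_rw [hlayer0, hlayer]
  -- both sides are `∑_{a,b} c_a c_b ∑_σ e^{-βH} σ_{(0,w_a)} σ_{(0,w_b) + π(n(e₀+e₁))}`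
  have hR : ∑ σ, rotWeight β 0 σ * ((∑ a, c a * spinAt ((0 : ZMod (2 * N)), w a) σ) *
      ∑ b, c b * spinAt (((0 : ZMod (2 * N)), w b) + evenShift n) σ) =
      ∑ a, ∑ b, c a * c b * ∑ σ, rotWeight β 0 σ *
        (spinAt ((0 : ZMod (2 * N)), w a) σ * spinAt (((0 : ZMod (2 * N)), w b) + evenShift n) σ) := by
    calc ∑ σ, rotWeight β 0 σ * ((∑ a, c a * spinAt ((0 : ZMod (2 * N)), w a) σ) *
          ∑ b, c b * spinAt (((0 : ZMod (2 * N)), w b) + evenShift n) σ)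
        = ∑ σ, ∑ a, ∑ b, c a * c b * (rotWeight β 0 σ *
            (spinAt ((0 : ZMod (2 * N)), w a) σ * spinAt (((0 : ZMod (2 * N)), w b) + evenShift n) σ)) := by
          refine Finset.sum_congr rfl fun σ _ => ?_
          rw [Finset.sum_mul_sum, Finset.mul_sum]
          refine Finset.sum_congr rfl fun a _ => ?_
          rw [Finset.mul_sum]
          refine Finset.sum_congr rfl fun b _ => ?_
          ring
      _ = ∑ a, ∑ σ, ∑ b, c a * c b * (rotWeight β 0 σ *
            (spinAt ((0 : ZMod (2 * N)), w a) σ * spinAt (((0 : ZMod (2 * N)), w b) + evenShift n) σ)) := by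
          rw [Finset.sum_comm]
      _ = ∑ a, ∑ b, ∑ σ, c a * c b * (rotWeight β 0 σ *
            (spinAt ((0 : ZMod (2 * N)), w a) σ * spinAt (((0 : ZMod (2 * N)), w b) + evenShift n) σ)) := by
          refine Finset.sum_congr rfl fun a _ => ?_
          rw [Finset.sum_comm]
      _ = _ := by
          refine Finset.sum_congr rfl fun a _ => Finset.sum_congr rfl fun b _ => ?_
          rw [Finset.mul_sum]
  have hL : isingPartitionFunction (rotGraph d'' N) Finset.univ β 0 .free *
        ∑ a, ∑ b, c a * c b *
          rotTwoPoint d'' N β ((0 : ZMod (2 * N)), w a) (((0 : ZMod (2 * N)), w b) + evenShift n) =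
      ∑ a, ∑ b, c a * c b * ∑ σ, rotWeight β 0 σ *
        (spinAt ((0 : ZMod (2 * N)), w a) σ * spinAt (((0 : ZMod (2 * N)), w b) + evenShift n) σ) := by
    rw [Finset.mul_sum]
    refine Finset.sum_congr rfl fun a _ => ?_
    rw [Finset.mul_sum]
    refine Finset.sum_congr rfl fun b _ => ?_
    rw [← Z_mul_rotTwoPoint_eq_sum]
    ring
  rw [hL, ← hR]
  rfl

/-- **Finite-volume spectral representation of diagonal forms** (the even-layer quadratic form is a
truncated moment sequence: positivity of `T T*`, ADC 2021 proof of Prop. 5.4 (iii), run through the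
spectral sum of App. §8.3, eq. (212)): on the rotated torus, `N ≥ 3`, any `β`, for coefficients `c_a`
at sites `(0, w_a)` of the even layer `x₀ + x₁ = 0`,
`W_N(m) = ∑_{a,b} c_a c_b ⟨σ_{(0,w_a)} σ_{(0,w_b) + π(m(e₀+e₁))}⟩^{rot}_{N;β} = ∫ tᵐ dν` for `0 ≤ m < N`,
for a finitely supported positive measure `ν` on `[0, ∞)`.
[cite: AizenmanDuminilCopinAnnals2021, arXiv:1912.07973 proof of Prop. 5.4 (iii) (p. 18) with Appendix §8.3, proof of Prop. 8.6, eq. (212)] -/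
theorem exists_rotDiagForm_moments {d'' N : ℕ} [NeZero N] (hN : 3 ≤ N) (β : ℝ) {ι : Type*} [Fintype ι]
    (c : ι → ℝ) (w : ι → TorusSite (d'' + 1) N) :
    ∃ ν : Measure ℝ, IsFiniteMeasure ν ∧ ν (Set.Iio 0) = 0 ∧ (∀ g : ℝ → ℝ, Integrable g ν) ∧
      ∀ m : ℕ, m < N → ∫ t, t ^ m ∂ν = ∑ a, ∑ b, c a * c b *
        rotTwoPoint d'' N β ((0 : ZMod (2 * N)), w a) (((0 : ZMod (2 * N)), w b) + evenShift (m : ZMod N)) := by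
  classical
  set Z := isingPartitionFunction (rotGraph d'' N) Finset.univ β 0 .free with hZ
  have hZpos : 0 < Z := isingPartitionFunction_pos _ _ β 0 _
  obtain ⟨ev, cc, hev, hcc, -, hspec⟩ :=
    trace_diagonal_pow_diagonal_pow_eq_sum (diagTransfer_posSemidef (d'' := d'') (N := N) β 0)
      (fun R : Layer (d'' + 1) N => ∑ a, c a * spinAt (w a) R)
  obtain ⟨ν, hfin, hsupp, hint, hmom⟩ := exists_atomicMeasure_of_spectralSum cc ev hcc hev hZpos N
  refine ⟨ν, hfin, hsupp, hint, fun m hm => ?_⟩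
  have hval : ((m : ZMod N)).val = m := ZMod.val_cast_of_lt hm
  have hrep : Z * ∑ a, ∑ b, c a * c b *
      rotTwoPoint d'' N β ((0 : ZMod (2 * N)), w a) (((0 : ZMod (2 * N)), w b) + evenShift (m : ZMod N)) =
      ∑ k, ∑ l, cc k l * (ev l ^ m * ev k ^ (N - m)) := by
    rw [hZ, Z_mul_rotDiagForm_eq_trace hN β c w, hval]
    exact hspec m (N - m)
  rw [hmom m hm, ← hrep, ← mul_assoc, inv_mul_cancel₀ hZpos.ne', one_mul]

/-- **Uniform bound on quadratic forms of the rotated-torus two-point function**: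
`∑_{a,b} c_a c_b ⟨σ_{u_a} σ_{v_b}⟩^{rot}_{N;β} ≤ (∑_a |c_a|)²`, since `0 ≤ ⟨σ_uσ_v⟩^{rot} ≤ 1` for
`β ≥ 0` (GKS I and `|σ| = 1`). [folklore] -/
theorem sum_mul_mul_rotTwoPoint_le {d'' N : ℕ} [NeZero N] {β : ℝ} (hβ : 0 ≤ β) {ι : Type*} [Fintype ι]
    (c : ι → ℝ) (u v : ι → RotSite d'' N) :
    ∑ a, ∑ b, c a * c b * rotTwoPoint d'' N β (u a) (v b) ≤ (∑ a, |c a|) ^ 2 := by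
  have hterm : ∀ a b, c a * c b * rotTwoPoint d'' N β (u a) (v b) ≤ |c a| * |c b| := by
    intro a b
    have h1 := rotTwoPoint_le_one (d'' := d'') (N := N) β (u a) (v b)
    have h0 := rotTwoPoint_nonneg (d'' := d'') (N := N) hβ (u a) (v b)
    have h2 : c a * c b ≤ |c a| * |c b| := by rw [← abs_mul]; exact le_abs_self _
    nlinarith [mul_nonneg (abs_nonneg (c a)) (abs_nonneg (c b))]
  rw [sq, Finset.sum_mul_sum]
  exact Finset.sum_le_sum fun a _ => Finset.sum_le_sum fun b _ => hterm a b

/-! ### The limit `N → ∞` along the rotated tori when `m*(β) = 0` -/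

/-- **Pointwise convergence of the rotated-torus two-point function when `m*(β) = 0`** (the
analogue of ADC 2021 Prop. 5.2 for the partially rotated periodic boxes, in `Tendsto` form along any
`N_j → ∞`): `⟨σ₀σ_{π(x)}⟩^{rot}_{N_j;β} → ⟨σ₀σ_x⟩⁺_β`. Extends `tendsto_rotTwoPoint_proj` (stated
for `β < β_c`) to every `β ≥ 0` with vanishing spontaneous magnetisation, in particular `β = β_c`
in `d ≥ 3`: Griffiths sandwich `abs_rotTwoPoint_sub_plusCorr_le` and Lebowitz–Martin-Löf
`freeCorr_eq_plusCorr_of_spontaneousMagnetization_eq_zero`.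
[cite: AizenmanDuminilCopinAnnals2021, arXiv:1912.07973 Prop. 5.2 and proof of Prop. 5.4 (iii) (p. 17–18)] -/
theorem tendsto_rotTwoPoint_proj_of_magnetization_eq_zero {d'' : ℕ} {β : ℝ} (hβ : 0 ≤ β)
    (hm : spontaneousMagnetization (d'' + 2) β = 0) {Nseq : ℕ → ℕ} [∀ j, NeZero (Nseq j)]
    (hN : Tendsto Nseq atTop atTop) (x : Site (d'' + 2)) :
    Tendsto (fun j => rotTwoPoint d'' (Nseq j) β 0 (rotProj d'' (Nseq j) x)) atTop
      (𝓝 (twoPointPlus (d'' + 2) β x)) := by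
  rcases eq_or_ne x 0 with rfl | hx
  · have : ∀ j, rotTwoPoint d'' (Nseq j) β 0 (rotProj d'' (Nseq j) 0) = 1 := fun j => by
      rw [map_zero]; simp [rotTwoPoint]
    simp only [this, twoPointPlus_zero]
    exact tendsto_const_nhds
  · rw [Metric.tendsto_atTop]
    intro ε hε
    obtain ⟨N₀, hN₀⟩ := abs_rotTwoPoint_sub_plusCorr_le (d'' := d'') hβ (x := 0) (y := x) hx.symm
      (freeCorr_eq_plusCorr_of_spontaneousMagnetization_eq_zero hβ hm _) (half_pos hε)
    obtain ⟨j₀, hj₀⟩ := eventually_atTop.1 (hN.eventually (eventually_ge_atTop N₀))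
    refine ⟨j₀, fun j hj => ?_⟩
    have key := hN₀ (Nseq j) (hj₀ j hj)
    rw [map_zero] at key
    rw [Real.dist_eq, twoPointPlus_eq_plusCorr_pair β hx]
    exact key.trans_lt (half_lt_self hε)

/-- A lattice point of the diagonal plane `{x₀ + x₁ = 0}` projects to the even layer `0` of the
rotated torus: `π(x) = (0, π(x)₂)`. [folklore] -/
theorem rotProj_eq_of_add_eq_zero {d'' N : ℕ} (x : Site (d'' + 2)) (hx : x 0 + x 1 = 0) :
    rotProj d'' N x = ((0 : ZMod (2 * N)), (rotProj d'' N x).2) := by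
  refine Prod.ext ?_ rfl
  rw [rotProj_apply_fst, hx, Int.cast_zero]

/-- The diagonal step on the rotated torus: `π(n(e₀ + e₁)) = (2n, n e_b)` (`evenShift n`), the
translation from the even layer `0` to the even layer `2n` in pulled-back coordinates. [folklore] -/
theorem rotProj_single_zero_add_single_one {d'' N : ℕ} [NeZero N] (n : ℕ) :
    rotProj d'' N (Pi.single 0 (n : ℤ) + Pi.single 1 (n : ℤ)) = evenShift (d'' := d'') ((n : ℕ) : ZMod N) := by
  refine Prod.ext ?_ ?_
  · rw [rotProj_apply_fst]
    simp only [evenShift, twoMul, ZMod.val_natCast]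
    have h1 : (1 : Fin (d'' + 2)) ≠ 0 := by simp
    simp only [Pi.add_apply, Pi.single_eq_same, Pi.single_eq_of_ne h1, Pi.single_eq_of_ne h1.symm, add_zero,
      zero_add]
    have h2 : ((2 * (n % N) : ℕ) : ZMod (2 * N)) = ((2 * n : ℕ) : ZMod (2 * N)) := by
      rw [ZMod.natCast_eq_natCast_iff', two_mul_mod_two_mul, two_mul_mod_two_mul, Nat.mod_mod]
    rw [h2]
    push_cast
    ring
  · funext j
    rw [rotProj_apply_snd]
    simp only [evenShift, layerShift]
    by_cases hj : j = 0
    · subst hj; simp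
    · have : (j.succ : Fin (d'' + 2)) ≠ 1 := fun h => hj (Fin.succ_injective _ (by rw [h]; rfl))
      simp [Pi.single_eq_of_ne this, Pi.single_eq_of_ne hj, Fin.succ_ne_zero]

/-- **The rotated-torus diagonal form converges to the infinite-volume diagonal form** (`m*(β) = 0`,
termwise convergence along `N_j = j + 3`): for lattice points `x_a` of the diagonal plane
`{x₀ + x₁ = 0}`, `∑_{a,b} c_a c_b ⟨σ_{π(x_a)} σ_{π(x_b) + π(n(e₀+e₁))}⟩^{rot}_{N_j;β} →
∑_{a,b} c_a c_b ⟨σ₀ σ_{x_b - x_a + n(e₀+e₁)}⟩⁺_β`.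
[cite: AizenmanDuminilCopinAnnals2021, arXiv:1912.07973 Prop. 5.2 and proof of Prop. 5.4 (iii) (p. 17–18)] -/
theorem tendsto_rotDiagForm {d'' : ℕ} {β : ℝ} (hβ : 0 ≤ β) (hm : spontaneousMagnetization (d'' + 2) β = 0)
    {ι : Type*} [Fintype ι] (c : ι → ℝ) (x : ι → Site (d'' + 2)) (hx : ∀ a, x a 0 + x a 1 = 0) (n : ℕ) :
    Tendsto (fun j : ℕ => ∑ a, ∑ b, c a * c b *
        rotTwoPoint d'' (j + 3) β ((0 : ZMod (2 * (j + 3))), (rotProj d'' (j + 3) (x a)).2)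
          (((0 : ZMod (2 * (j + 3))), (rotProj d'' (j + 3) (x b)).2) + evenShift ((n : ℕ) : ZMod (j + 3))))
      atTop (𝓝 (∑ a, ∑ b, c a * c b *
        twoPointPlus (d'' + 2) β (x b - x a + (Pi.single 0 (n : ℤ) + Pi.single 1 (n : ℤ))))) := by
  classical
  refine tendsto_finsetSum _ fun a _ => tendsto_finsetSum _ fun b _ => ?_
  refine Tendsto.const_mul _ ?_
  have hN : Tendsto (fun j : ℕ => j + 3) atTop atTop := tendsto_add_atTop_nat 3
  have key := tendsto_rotTwoPoint_proj_of_magnetization_eq_zero (Nseq := fun j => j + 3) hβ hm hN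
    (x b - x a + (Pi.single 0 (n : ℤ) + Pi.single 1 (n : ℤ)))
  refine key.congr fun j => ?_
  rw [map_add, map_sub, rotProj_single_zero_add_single_one, ← rotProj_eq_of_add_eq_zero (x a) (hx a),
    ← rotProj_eq_of_add_eq_zero (x b) (hx b), rotTwoPoint_eq_zero_sub β (rotProj d'' (j + 3) (x a)),
    add_sub_right_comm]

/-! ### Infinite volume: diagonal forms of `⟨σ₀σ_x⟩⁺_β` are Hausdorff moment sequences when `m*(β) = 0` -/

/-- **Diagonal-frame spectral representation, Hausdorff-moment form** (Aizenman–Duminil-Copin 2021,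
proof of Prop. 5.4 (iii) — positivity of `TT*` on the even diagonal layers of the partially rotated
periodic boxes — combined with the proof of Prop. 8.6 (= Prop. 5.3), for finitely supported `v`):
for the nearest-neighbour Ising model on `ℤ^{d''+2}` at `β ≥ 0` with `m*(β) = 0` (all `β < β_c`;
`β = β_c` for `d'' + 2 ≥ 3`) and real coefficients `c_a` at lattice points `x_a` of the diagonal
plane `{x₀ + x₁ = 0}`, there is a finite positive measure `μ` on `[0, 1]` with
`∑_{a,b} c_a c_b ⟨σ₀ σ_{x_b - x_a + n(e₀+e₁)}⟩⁺_β = ∫ tⁿ dμ(t)` for all `n : ℕ`. Proof: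
`exists_rotDiagForm_moments`, `tendsto_rotDiagForm`, and the moment criterion
`exists_hausdorffMeasure_of_momentLimit` with the bound `(∑_a |c_a|)²`.
[cite: AizenmanDuminilCopinAnnals2021, arXiv:1912.07973 proof of Prop. 5.4 (iii) (p. 18) and Appendix §8.3 Prop. 8.6 (= Prop. 5.3)] -/
theorem exists_diagForm_hausdorffMeasure {d'' : ℕ} {β : ℝ} (hβ : 0 ≤ β)
    (hm : spontaneousMagnetization (d'' + 2) β = 0) {ι : Type*} [Fintype ι]
    (c : ι → ℝ) (x : ι → Site (d'' + 2)) (hx : ∀ a, x a 0 + x a 1 = 0) :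
    ∃ μ : Measure ℝ, IsFiniteMeasure μ ∧ μ (Set.Icc (0 : ℝ) 1)ᶜ = 0 ∧
      ∀ n : ℕ, ∑ a, ∑ b, c a * c b *
        twoPointPlus (d'' + 2) β (x b - x a + (Pi.single 0 (n : ℤ) + Pi.single 1 (n : ℤ))) = ∫ t, t ^ n ∂μ := by
  classical
  have hex : ∀ j : ℕ, ∃ ν : Measure ℝ, IsFiniteMeasure ν ∧ ν (Set.Iio 0) = 0 ∧
      (∀ g : ℝ → ℝ, Integrable g ν) ∧
      ∀ m : ℕ, m < j + 3 → ∫ t, t ^ m ∂ν = ∑ a, ∑ b, c a * c b *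
        rotTwoPoint d'' (j + 3) β ((0 : ZMod (2 * (j + 3))), (rotProj d'' (j + 3) (x a)).2)
          (((0 : ZMod (2 * (j + 3))), (rotProj d'' (j + 3) (x b)).2) + evenShift ((m : ℕ) : ZMod (j + 3))) :=
    fun j => exists_rotDiagForm_moments (N := j + 3) (by omega) β c _
  choose ν hfin hsupp hint hmom using hex
  refine exists_hausdorffMeasure_of_momentLimit (M := (∑ a, |c a|) ^ 2) _ ν hfin
    hsupp (fun j n => hint j _) (fun j n hnj => ?_) (fun n => ?_)
  · rw [hmom j n (by omega)]
    exact sum_mul_mul_rotTwoPoint_le hβ c _ _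
  · refine (tendsto_rotDiagForm hβ hm c x hx n).congr' ?_
    rw [EventuallyEq, eventually_atTop]
    exact ⟨n, fun j hj => (hmom j n (by omega)).symm⟩

/-! ### The sub-stub -/

/-- Diagonal-plane points of `ℤ³`: for `x_a = (a₀, -a₀, a₁)`,
`x_b - x_a + n(e₀ + e₁) = ((b₀ - a₀) + n, -(b₀ - a₀) + n, b₁ - a₁)`. [folklore] -/
theorem diagSite_sub_add_single (n : ℤ) (a b : Fin 2 → ℤ) :
    (![b 0, -b 0, b 1] : Site 3) - ![a 0, -a 0, a 1] + (Pi.single 0 n + Pi.single 1 n) =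
      ![(b 0 - a 0) + n, -(b 0 - a 0) + n, b 1 - a 1] := by
  funext j
  fin_cases j <;> simp
  ring

/-- **Registered sub-stub `stub_slabModeExpDecay_auxDiagHausdorff`** (brick of
`stub_slabModeExpDecay` on stmt-CriticalPhenomena-4799; signature EXACTLY as registered): the
DIAGONAL-FRAME slab spectral representation of `G = criticalTwoPoint 3 = ⟨σ₀σ_·⟩⁺_{β_c(3)}` — the
`u = e₀ + e₁` analogue of `stub_slabSpectralRepresentation`. For every finite `s ⊂ ℤ²`
(parametrising the diagonal plane `{x₀ + x₁ = 0}` by `p = (m, z) ↦ (m, -m, z)`) and every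
`v : ℤ² → ℝ` there is a finite positive measure `μ` on `[0, 1]` with, for all `n : ℕ`,
`∑_{p,q ∈ s} v p v q G((p₀ - q₀) + n, -(p₀ - q₀) + n, p₁ - q₁) = ∫ tⁿ dμ`. Proof:
`exists_diagForm_hausdorffMeasure` at `d'' = 1`, `β = β_c(3) ≥ 0` (`criticalBeta_nonneg`),
`m*(β_c(3)) = 0` (`spontaneousMagnetization_criticalBeta_eq_zero_holds`, ADS 2015), index type `s`,
coefficients `v|_s`, points `(a₀, -a₀, a₁)`; then `diagSite_sub_add_single` and the order of
summation is swapped.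
[cite: AizenmanDuminilCopinAnnals2021, arXiv:1912.07973 proof of Prop. 5.4 (iii) (p. 18) and Appendix §8.3 Prop. 8.6 (= Prop. 5.3)] -/
theorem stub_slabModeExpDecay_auxDiagHausdorff : ∀ (s : Finset (Fin 2 → ℤ)) (v : (Fin 2 → ℤ) → ℝ), ∃ μ : MeasureTheory.Measure ℝ, MeasureTheory.IsFiniteMeasure μ ∧ μ (Set.Icc (0 : ℝ) 1)ᶜ = 0 ∧ ∀ n : ℕ, ∑ p ∈ s, ∑ q ∈ s, v p * v q * criticalTwoPoint 3 (![(p 0 - q 0) + (n : ℤ), -(p 0 - q 0) + (n : ℤ), p 1 - q 1] : Site 3) = ∫ t, t ^ n ∂μ := by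
  intro s v
  classical
  have hβ : (0 : ℝ) ≤ criticalBeta 3 := criticalBeta_nonneg 3
  have hm : spontaneousMagnetization (1 + 2) (criticalBeta (1 + 2)) = 0 :=
    spontaneousMagnetization_criticalBeta_eq_zero_holds (d := 1 + 2) (by norm_num)
  obtain ⟨μ, hμfin, hμsupp, hμ⟩ := exists_diagForm_hausdorffMeasure (d'' := 1) hβ hm (fun a : s => v a)
    (fun a : s => (![(a : Fin 2 → ℤ) 0, -(a : Fin 2 → ℤ) 0, (a : Fin 2 → ℤ) 1] : Site 3)) (fun a => by simp)
  refine ⟨μ, hμfin, hμsupp, fun n => ?_⟩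
  rw [← hμ n, Finset.sum_comm, ← Finset.sum_coe_sort s]
  refine Finset.sum_congr rfl fun a _ => ?_
  rw [← Finset.sum_coe_sort s]
  refine Finset.sum_congr rfl fun b _ => ?_
  rw [diagSite_sub_add_single, mul_comm (v b) (v a)]
  rfl

/-- **All diagonal frames** (corollary, by the hyperoctahedral invariance of `⟨σ₀σ_x⟩⁺_β`,
`twoPointPlus_signedPerm`): the same Hausdorff-moment representation holds for the image of the
configuration under any signed coordinate permutation `x ↦ (ε_i x_{π⁻¹ i})_i` of `ℤ³`, i.e. for the
forms `n ↦ ∑ v_x v_y G(y - x + n u)` with `x, y` on the plane through `0` spanned by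
`ε_a e_a - ε_b e_b` and `e_c`, in every diagonal direction `u = ε_a e_a + ε_b e_b` (`{a, b, c} = {0, 1, 2}`).
[cite: AizenmanDuminilCopinAnnals2021, arXiv:1912.07973 proof of Prop. 5.4 (iii) (p. 18) and Appendix §8.3 Prop. 8.6 (= Prop. 5.3)] -/
theorem stub_slabModeExpDecay_auxDiagHausdorff_signedPerm (π : Equiv.Perm (Fin 3)) (ε : Fin 3 → ℤˣ)
    (s : Finset (Fin 2 → ℤ)) (v : (Fin 2 → ℤ) → ℝ) :
    ∃ μ : Measure ℝ, IsFiniteMeasure μ ∧ μ (Set.Icc (0 : ℝ) 1)ᶜ = 0 ∧ ∀ n : ℕ,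
      ∑ p ∈ s, ∑ q ∈ s, v p * v q * criticalTwoPoint 3
        (Site.signedPerm π ε (![(p 0 - q 0) + (n : ℤ), -(p 0 - q 0) + (n : ℤ), p 1 - q 1] : Site 3)) =
      ∫ t, t ^ n ∂μ := by
  have hinv : ∀ y : Site 3, criticalTwoPoint 3 (Site.signedPerm π ε y) = criticalTwoPoint 3 y :=
    fun y => twoPointPlus_signedPerm _ π ε y
  simp only [hinv]
  exact stub_slabModeExpDecay_auxDiagHausdorff s v

end Summit.CriticalPhenomena.Ising3DConformalLimit.Cruxes.DirectCorrelationStableTail.SelfEnergyPickInversion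

end
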